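import Mathlib
import HarnessLib

/-!
# Route `PoloidalWindowDoor`, item `LrcModEntire` (stmt-NavierStokesRegularity-20428), cell (Q4-curved), v18 research child «UNIFORMLY CURVED BASE CURVE» —
# UC-ENTRANCE: the negated v18 literal `¬Y_T` in its positive working form (class-free)

Cell ns-regularity-ideate, helper seat ns-k2-port-2 g9 under the LEAD of item 20428 (ns-poloidal-K2-p3 g18; v18 split of `stub_Q4curvedAperiodicVerticalCurvedLimits` by
the literal `Y_T` of ns-poloidal-K2-p2 g19, endorsed 2026-08-30T03:50:22Z); `--supports stmt-NavierStokesRegularity-20428 --as helper`.  CLASS-FREE (any map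
`Γ : ℝ → E` into a normed group; stated for `ℝ³`).

* ★ `uniformlyCurved_of_not_flat` — `¬Y_T`, i.e. `¬ ∃ a : ℕ → ℝ, ∀ A ε > 0, ∀ᶠ n, ∀ |s| ≤ A, ‖Γ″(aₙ + s)‖ ≤ ε`, implies the UNIFORM CURVATURE form:
  `∃ A ε > 0, ∀ c, ∃ s, |s| ≤ A ∧ ε < ‖Γ″(c + s)‖` — every arc of half-length `A` carries a point of curvature `> ε` (diagonal choice `A := n + 1`, `ε := 1/(n + 1)`).
* `not_flat_of_uniformlyCurved` — the converse; so the research child's literal is EQUIVALENT to the working form (`uniformlyCurved_iff_not_flat`).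

WHAT THIS IS NOT: not a claim about Navier–Stokes regularity; closes nothing (entrance of the RESEARCH slot `…CurvedLimitsUniformlyCurved`);
items 20428 / 19708 / 27893 OPEN (bears_on LADDER-NS N0).
-/

noncomputable section

set_option linter.dupNamespace false
set_option linter.style.longLine false

namespace Summit.NavierStokesRegularity.NavierStokesRegularity.Theorems.PoloidalWindowDoorLrcModEntireQ4CurvedUniformlyCurved

open Set Function Filter Topology Metric

/-- ★ **`¬Y_T` ⇒ UNIFORMLY CURVED**: if no sequence of base points flattens the arcs, then some arc half-length `A` and level `ε > 0` work uniformly: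
every arc `[c − A, c + A]` carries a point with `‖Γ″‖ > ε`. -/
theorem uniformlyCurved_of_not_flat {Γ : ℝ → EuclideanSpace ℝ (Fin 3)}
    (hnot : ¬ ∃ a : ℕ → ℝ, ∀ A ε : ℝ, 0 < ε → ∀ᶠ n in atTop, ∀ s : ℝ, |s| ≤ A → ‖deriv (deriv Γ) (a n + s)‖ ≤ ε) :
    ∃ A ε : ℝ, 0 < A ∧ 0 < ε ∧ ∀ c : ℝ, ∃ s : ℝ, |s| ≤ A ∧ ε < ‖deriv (deriv Γ) (c + s)‖ := by
  by_contra hno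
  push Not at hno
  -- for every `n` a base point `a n` whose arc of half-length `n + 1` is `1/(n+1)`-flat
  have hch : ∀ n : ℕ, ∃ c : ℝ, ∀ s : ℝ, |s| ≤ (n : ℝ) + 1 → ‖deriv (deriv Γ) (c + s)‖ ≤ 1 / ((n : ℝ) + 1) :=
    fun n => hno ((n : ℝ) + 1) (1 / ((n : ℝ) + 1)) (by positivity) (by positivity)
  choose a ha using hch
  refine hnot ⟨a, fun A ε hε => ?_⟩
  -- eventually `n + 1 ≥ A` and `1/(n+1) ≤ ε`
  obtain ⟨N₁, hN₁⟩ := exists_nat_ge A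
  obtain ⟨N₂, hN₂⟩ := exists_nat_ge (1 / ε)
  filter_upwards [eventually_ge_atTop (max N₁ N₂)] with n hn s hs
  have hn₁ : (N₁ : ℝ) ≤ n := by exact_mod_cast le_trans (le_max_left _ _) hn
  have hn₂ : (N₂ : ℝ) ≤ n := by exact_mod_cast le_trans (le_max_right _ _) hn
  have hsA : |s| ≤ (n : ℝ) + 1 := by linarith
  have hεn : 1 / ((n : ℝ) + 1) ≤ ε := by
    rw [div_le_iff₀ (by positivity)]
    have h1 : 1 / ε ≤ (n : ℝ) + 1 := by linarith
    rw [div_le_iff₀ hε] at h1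
    linarith
  exact (ha n s hsA).trans hεn

/-- **The converse**: a uniformly curved curve has no flattening sequence of arcs. -/
theorem not_flat_of_uniformlyCurved {Γ : ℝ → EuclideanSpace ℝ (Fin 3)}
    (huc : ∃ A ε : ℝ, 0 < A ∧ 0 < ε ∧ ∀ c : ℝ, ∃ s : ℝ, |s| ≤ A ∧ ε < ‖deriv (deriv Γ) (c + s)‖) :
    ¬ ∃ a : ℕ → ℝ, ∀ A ε : ℝ, 0 < ε → ∀ᶠ n in atTop, ∀ s : ℝ, |s| ≤ A → ‖deriv (deriv Γ) (a n + s)‖ ≤ ε := by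
  rintro ⟨a, ha⟩
  obtain ⟨A, ε, -, hε, huc⟩ := huc
  obtain ⟨n, hn⟩ := (ha A ε hε).exists
  obtain ⟨s, hs, hlt⟩ := huc (a n)
  exact absurd (hn s hs) (not_le.2 hlt)

/-- **The v18 research literal in working form**: `¬Y_T ↔` uniformly curved. -/
theorem uniformlyCurved_iff_not_flat {Γ : ℝ → EuclideanSpace ℝ (Fin 3)} :
    (∃ A ε : ℝ, 0 < A ∧ 0 < ε ∧ ∀ c : ℝ, ∃ s : ℝ, |s| ≤ A ∧ ε < ‖deriv (deriv Γ) (c + s)‖) ↔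
      ¬ ∃ a : ℕ → ℝ, ∀ A ε : ℝ, 0 < ε → ∀ᶠ n in atTop, ∀ s : ℝ, |s| ≤ A → ‖deriv (deriv Γ) (a n + s)‖ ≤ ε :=
  ⟨not_flat_of_uniformlyCurved, uniformlyCurved_of_not_flat⟩

end Summit.NavierStokesRegularity.NavierStokesRegularity.Theorems.PoloidalWindowDoorLrcModEntireQ4CurvedUniformlyCurved

end
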